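import Summits.CriticalPhenomena.PercolationContinuityZ3.Theorems.PercNearOneGluingNoHeavyLowerTailKnQuestion8CoefficientwiseCoreClassSeriesMain
import Summits.CriticalPhenomena.PercolationContinuityZ3.Theorems.PercNearOneGluingNoHeavyLowerTailKnQuestion8CoefficientwiseCoreClassKernelMixFull
import Summits.CriticalPhenomena.PercolationContinuityZ3.Theorems.PercNearOneGluingNoHeavyLowerTailKnQuestion8CoefficientwiseCoreClassDomParallel
import HarnessLib

/-!
# KB-MIX-FULL is stable under parallel composition with a middle graph carrying a domination map

Support file (`--supports stmt-CriticalPhenomena-4575`, closed), prover `prim-cplus-coupling` (gen 35).  No definitions, no notations, no named facts,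
no sorries; standard axioms.  Memo `prim-cplus-coupling/A5-COUPLING-gen31.md` §1.5 (pencil) and `A5-COUPLING-gen35.md` §4(c).  Companions
`…CoreClassDomParallel` (domination maps tensorise; cluster splitting across the 2-separation `{a, b}`), `…CoreClassKernelMixFull`.

Setting: PARALLEL COMPOSITION `E₁ ∥ E₂` at the terminals: disjoint edge sets whose edges share no vertex other than `a, b`.
* `Coefficientwise.openCluster_union_subset_of_parts` — if `o ∉ C_r(ω₁)` and `o ∉ C_r(ω₂)` (`{r, o} = {a, b}`, `ω_s ⊆ E_s`) then
  `C_r(ω₁ ∪ ω₂) ⊆ C_r(ω₁) ∪ C_r(ω₂)`; so the wall of `E₁ ∥ E₂` is the product of the walls and on it `P = P₁ ∪ P₂`, `Q = Q₁ ∪ Q₂`.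
* `Coefficientwise.coreClass_kernelMixFull_parallel` — **KB-MIX ∥ MAP.**  If `ψ₂` is a domination map of `(E₂; a, b)` and, for every wall colouring `ω₂`
  of `E₂`, KB-MIX-FULL of `(E₁; a, b)` holds at the glued test functions `h(· ∪ S₂(ψ₂ω₂)), k(· ∪ S₂(ψ₂ω₂))` and levels `hᵃ(· ∪ P₂), hᵇ(· ∪ Q₂), kᵃ(· ∪ P₂),
  kᵇ(· ∪ Q₂)` (`P₂ = C_a ω₂`, `Q₂ = C_b(E₂∖ω₂)`, `S₂(η) = C_a η ∪ C_b η`), then KB-MIX-FULL of `(E₁ ∪ E₂; a, b)` holds at `(h, k; hᵃ, hᵇ; kᵃ, kᵇ)`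
  (`h, k ≥ 0` monotone).  Proof: for fixed `ω₂` on the wall of `E₂` the wall terms of the composed graph are exactly the glued wall terms of `E₁`; the glued
  supply of `E₁` at `ω₂` is dominated by the true supply at `(ω₁, ψ₂ω₂)`, and these slices are disjoint by injectivity of `ψ₂`.
[cite: KozmaNitzan2024, Questions 8–9 (§5.5 p. 36) (context: the Question-8 pocket covariance programme)]
-/

namespace Summit.CriticalPhenomena.PercolationContinuityZ3.Theorems

open Finset Literature.Probability.Percolation

namespace Coefficientwise

variable {ι V : Type*}

open Classical in
/-- **No crossing in the parts ⇒ no crossing in the parallel composition, and the cluster splits.**  `E₁, E₂` edge sets whose edges share no vertex other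
than `r, o`; `ω₁ ⊆ E₁`, `ω₂ ⊆ E₂`; if `o ∉ C_r(ω₁)` and `o ∉ C_r(ω₂)` then `C_r(ω₁ ∪ ω₂) ⊆ C_r(ω₁) ∪ C_r(ω₂)` (in particular `o ∉ C_r(ω₁ ∪ ω₂)`).
[cite: KozmaNitzan2024, §5.5 (context only; folklore)] -/
theorem openCluster_union_subset_of_parts (ends : ι → Sym2 V) (E₁ E₂ ω₁ ω₂ : Finset ι) (r o : V)
    (hsep : ∀ i ∈ E₁, ∀ j ∈ E₂, ∀ v, v ∈ ends i → v ∈ ends j → v = r ∨ v = o)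
    (h₁ : ω₁ ⊆ E₁) (h₂ : ω₂ ⊆ E₂)
    (ho₁ : o ∉ openCluster (ends '' (↑ω₁ : Set ι)) r) (ho₂ : o ∉ openCluster (ends '' (↑ω₂ : Set ι)) r) :
    openCluster (ends '' (↑(ω₁ ∪ ω₂) : Set ι)) r ⊆ openCluster (ends '' (↑ω₁ : Set ι)) r ∪ openCluster (ends '' (↑ω₂ : Set ι)) r := by
  refine openCluster_subset_of_closed ends (ω₁ ∪ ω₂) r (S := openCluster (ends '' (↑ω₁ : Set ι)) r ∪ openCluster (ends '' (↑ω₂ : Set ι)) r)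
    (Or.inl (mem_openCluster_self _ _)) ?_
  intro i hi p q he hp
  have hpi : p ∈ ends i := by rw [he]; exact Sym2.mem_mk_left p q
  -- generic step: `i` in part `A`, `p` in the part-`B` cluster forces `p = r` (the separation), hence `p` is in the part-`A` cluster too
  have step : ∀ (A B ωA ωB : Finset ι), (∀ i ∈ A, ∀ j ∈ B, ∀ v, v ∈ ends i → v ∈ ends j → v = r ∨ v = o) → ωA ⊆ A → ωB ⊆ B →
      o ∉ openCluster (ends '' (↑ωB : Set ι)) r → i ∈ ωA →
      p ∈ openCluster (ends '' (↑ωB : Set ι)) r → p ∈ openCluster (ends '' (↑ωA : Set ι)) r := by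
    intro A B ωA ωB hAB hA hB hoB hiA hpB
    by_cases hpr : p = r
    · rw [hpr]; exact mem_openCluster_self _ _
    · obtain ⟨j, hj, hpj⟩ := exists_edge_of_mem_openCluster ends hpB hpr
      rcases hAB i (hA hiA) j (hB hj) p hpi hpj with hpr' | hpo
      · exact absurd hpr' hpr
      · exact absurd (hpo ▸ hpB) hoB
  rcases Finset.mem_union.mp hi with hi₁ | hi₂
  · have hp₁ : p ∈ openCluster (ends '' (↑ω₁ : Set ι)) r := by
      rcases hp with hp | hp
      · exact hp
      · exact step E₁ E₂ ω₁ ω₂ hsep h₁ h₂ ho₂ hi₁ hp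
    exact Or.inl (mem_openCluster_of_edge ends hi₁ he hp₁)
  · have hp₂ : p ∈ openCluster (ends '' (↑ω₂ : Set ι)) r := by
      rcases hp with hp | hp
      · exact step E₂ E₁ ω₂ ω₁ (fun i hi j hj v hvi hvj => hsep j hj i hi v hvj hvi) h₂ h₁ ho₁ hi₂ hp
      · exact hp
    exact Or.inr (mem_openCluster_of_edge ends hi₂ he hp₂)

open Classical in
/-- **KB-MIX ∥ MAP (KB-MIX-FULL is stable under parallel composition with a middle graph carrying a domination map).**  `E₁, E₂` disjoint, their edges
sharing no vertex other than `a, b`; `h, k ≥ 0` monotone; `ψ₂` maps the wall colourings of `E₂` injectively into `2^{E₂}`.  Hypothesis: for every wall colouring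
`ω₂` of `E₂` (`b ∉ C_a ω₂`, `b ∉ C_a(E₂∖ω₂)`), KB-MIX-FULL of `(E₁; a, b)` at the glued functions
`X ↦ h(X ∪ S₂(ψ₂ω₂)), k(X ∪ S₂(ψ₂ω₂)); hᵃ(X ∪ C_a ω₂), hᵇ(X ∪ C_b(E₂∖ω₂)); kᵃ(X ∪ C_a ω₂), kᵇ(X ∪ C_b(E₂∖ω₂))` (`S₂(η) = C_a η ∪ C_b η`).
Conclusion: KB-MIX-FULL of `(E₁ ∪ E₂; a, b)` at `(h, k; hᵃ, hᵇ; kᵃ, kᵇ)`.  (When `ψ₂` also COVERS — `C_a ω₂ ∪ C_b(E₂∖ω₂) ⊆ S₂(ψ₂ω₂)` — the glued functions are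
admissible levels, so the hypothesis is an instance of 'KB-MIX-FULL of `E₁` for all levels'.)
[cite: KozmaNitzan2024, Questions 8–9 (§5.5 p. 36) (context: the Question-8 pocket covariance programme)] -/
theorem coreClass_kernelMixFull_parallel (ends : ι → Sym2 V) (E₁ E₂ : Finset ι) (a b : V) (hdisj : Disjoint E₁ E₂)
    (hsep : ∀ i ∈ E₁, ∀ j ∈ E₂, ∀ v, v ∈ ends i → v ∈ ends j → v = a ∨ v = b)
    (h k ha hb ka kb : Set V → ℝ) (hh : Monotone h) (hk : Monotone k) (h0 : ∀ X, 0 ≤ h X) (k0 : ∀ X, 0 ≤ k X)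
    (ψ₂ : Finset ι → Finset ι)
    (hψE : ∀ ω, ω ⊆ E₂ → b ∉ openCluster (ends '' (↑ω : Set ι)) a → b ∉ openCluster (ends '' (↑(E₂ \ ω) : Set ι)) a → ψ₂ ω ⊆ E₂)
    (hψinj : ∀ ω₁ ω₂, ω₁ ⊆ E₂ → b ∉ openCluster (ends '' (↑ω₁ : Set ι)) a → b ∉ openCluster (ends '' (↑(E₂ \ ω₁) : Set ι)) a →
      ω₂ ⊆ E₂ → b ∉ openCluster (ends '' (↑ω₂ : Set ι)) a → b ∉ openCluster (ends '' (↑(E₂ \ ω₂) : Set ι)) a → ψ₂ ω₁ = ψ₂ ω₂ → ω₁ = ω₂)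
    (hmix : ∀ ω₂, ω₂ ⊆ E₂ → b ∉ openCluster (ends '' (↑ω₂ : Set ι)) a → b ∉ openCluster (ends '' (↑(E₂ \ ω₂) : Set ι)) a →
      0 ≤ (∑ ω₁ ∈ E₁.powerset,
        h ((openCluster (ends '' (↑ω₁ : Set ι)) a ∪ openCluster (ends '' (↑ω₁ : Set ι)) b) ∪
            (openCluster (ends '' (↑(ψ₂ ω₂) : Set ι)) a ∪ openCluster (ends '' (↑(ψ₂ ω₂) : Set ι)) b)) *
          k ((openCluster (ends '' (↑ω₁ : Set ι)) a ∪ openCluster (ends '' (↑ω₁ : Set ι)) b) ∪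
            (openCluster (ends '' (↑(ψ₂ ω₂) : Set ι)) a ∪ openCluster (ends '' (↑(ψ₂ ω₂) : Set ι)) b)))
      + ∑ ω₁ ∈ E₁.powerset.filter (fun ω₁ : Finset ι => b ∉ openCluster (ends '' (↑ω₁ : Set ι)) a ∧ b ∉ openCluster (ends '' (↑(E₁ \ ω₁) : Set ι)) a),
        (ha (openCluster (ends '' (↑ω₁ : Set ι)) a ∪ openCluster (ends '' (↑ω₂ : Set ι)) a)
          - hb (openCluster (ends '' (↑(E₁ \ ω₁) : Set ι)) b ∪ openCluster (ends '' (↑(E₂ \ ω₂) : Set ι)) b)) *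
        (ka (openCluster (ends '' (↑ω₁ : Set ι)) a ∪ openCluster (ends '' (↑ω₂ : Set ι)) a)
          - kb (openCluster (ends '' (↑(E₁ \ ω₁) : Set ι)) b ∪ openCluster (ends '' (↑(E₂ \ ω₂) : Set ι)) b))) :
    0 ≤ (∑ ω ∈ (E₁ ∪ E₂).powerset,
        h (openCluster (ends '' (↑ω : Set ι)) a ∪ openCluster (ends '' (↑ω : Set ι)) b) *
          k (openCluster (ends '' (↑ω : Set ι)) a ∪ openCluster (ends '' (↑ω : Set ι)) b))
      + ∑ ω ∈ (E₁ ∪ E₂).powerset.filter (fun ω : Finset ι => b ∉ openCluster (ends '' (↑ω : Set ι)) a ∧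
            b ∉ openCluster (ends '' (↑((E₁ ∪ E₂) \ ω) : Set ι)) a),
        (ha (openCluster (ends '' (↑ω : Set ι)) a) - hb (openCluster (ends '' (↑((E₁ ∪ E₂) \ ω) : Set ι)) b)) *
          (ka (openCluster (ends '' (↑ω : Set ι)) a) - kb (openCluster (ends '' (↑((E₁ ∪ E₂) \ ω) : Set ι)) b)) := by
  set C : Finset ι → V → Set V := fun ω x => openCluster (ends '' (↑ω : Set ι)) x with hC
  set T₁ : Finset (Finset ι) := E₁.powerset.filter (fun ω₁ : Finset ι => b ∉ C ω₁ a ∧ b ∉ C (E₁ \ ω₁) a) with hT₁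
  set T₂ : Finset (Finset ι) := E₂.powerset.filter (fun ω₂ : Finset ι => b ∉ C ω₂ a ∧ b ∉ C (E₂ \ ω₂) a) with hT₂
  -- the glued quantities
  set Sup : Finset ι → Finset ι → ℝ := fun ω₂ ω₁ =>
    h ((C ω₁ a ∪ C ω₁ b) ∪ (C (ψ₂ ω₂) a ∪ C (ψ₂ ω₂) b)) * k ((C ω₁ a ∪ C ω₁ b) ∪ (C (ψ₂ ω₂) a ∪ C (ψ₂ ω₂) b)) with hSup
  set Dem : Finset ι → Finset ι → ℝ := fun ω₂ ω₁ =>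
    (ha (C ω₁ a ∪ C ω₂ a) - hb (C (E₁ \ ω₁) b ∪ C (E₂ \ ω₂) b)) * (ka (C ω₁ a ∪ C ω₂ a) - kb (C (E₁ \ ω₁) b ∪ C (E₂ \ ω₂) b)) with hDem
  change ∀ ω₂, ω₂ ⊆ E₂ → b ∉ C ω₂ a → b ∉ C (E₂ \ ω₂) a → 0 ≤ (∑ ω₁ ∈ E₁.powerset, Sup ω₂ ω₁) + ∑ ω₁ ∈ T₁, Dem ω₂ ω₁ at hmix
  change 0 ≤ (∑ ω ∈ (E₁ ∪ E₂).powerset, h (C ω a ∪ C ω b) * k (C ω a ∪ C ω b))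
      + ∑ ω ∈ (E₁ ∪ E₂).powerset.filter (fun ω : Finset ι => b ∉ C ω a ∧ b ∉ C ((E₁ ∪ E₂) \ ω) a),
        (ha (C ω a) - hb (C ((E₁ ∪ E₂) \ ω) b)) * (ka (C ω a) - kb (C ((E₁ ∪ E₂) \ ω) b))
  have hmono : ∀ {ω ω' : Finset ι} (x : V), ω ⊆ ω' → C ω x ⊆ C ω' x := fun x hle => openCluster_image_mono ends hle x
  have hsep' : ∀ i ∈ E₁, ∀ j ∈ E₂, ∀ v, v ∈ ends i → v ∈ ends j → v = b ∨ v = a :=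
    fun i hi j hj v hvi hvj => (hsep i hi j hj v hvi hvj).symm
  have hsd : ∀ ω₁ ω₂, ω₁ ⊆ E₁ → ω₂ ⊆ E₂ → (E₁ ∪ E₂) \ (ω₁ ∪ ω₂) = (E₁ \ ω₁) ∪ (E₂ \ ω₂) :=
    fun ω₁ ω₂ h₁ h₂ => sdiff_union_sdiff E₁ E₂ ω₁ ω₂ hdisj h₁ h₂
  -- the wall of the composition is the product of the walls
  have hwall : ∀ ω₁ ω₂, ω₁ ⊆ E₁ → ω₂ ⊆ E₂ →
      ((b ∉ C (ω₁ ∪ ω₂) a ∧ b ∉ C ((E₁ ∪ E₂) \ (ω₁ ∪ ω₂)) a) ↔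
        ((b ∉ C ω₁ a ∧ b ∉ C (E₁ \ ω₁) a) ∧ (b ∉ C ω₂ a ∧ b ∉ C (E₂ \ ω₂) a))) := by
    intro ω₁ ω₂ h₁ h₂
    rw [hsd ω₁ ω₂ h₁ h₂]
    constructor
    · rintro ⟨hR, hB⟩
      exact ⟨⟨fun h' => hR (hmono a Finset.subset_union_left h'), fun h' => hB (hmono a Finset.subset_union_left h')⟩,
        ⟨fun h' => hR (hmono a Finset.subset_union_right h'), fun h' => hB (hmono a Finset.subset_union_right h')⟩⟩
    · rintro ⟨⟨hR₁, hB₁⟩, ⟨hR₂, hB₂⟩⟩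
      refine ⟨fun h' => ?_, fun h' => ?_⟩
      · rcases openCluster_union_subset_of_parts ends E₁ E₂ ω₁ ω₂ a b hsep h₁ h₂ hR₁ hR₂ h' with h'' | h''
        · exact hR₁ h''
        · exact hR₂ h''
      · rcases openCluster_union_subset_of_parts ends E₁ E₂ (E₁ \ ω₁) (E₂ \ ω₂) a b hsep Finset.sdiff_subset Finset.sdiff_subset hB₁ hB₂ h'
          with h'' | h''
        · exact hB₁ h''
        · exact hB₂ h''
  -- on the wall the clusters split
  have hPa : ∀ ω₁ ω₂, ω₁ ⊆ E₁ → ω₂ ⊆ E₂ → b ∉ C ω₁ a → b ∉ C ω₂ a → C (ω₁ ∪ ω₂) a = C ω₁ a ∪ C ω₂ a := by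
    intro ω₁ ω₂ h₁ h₂ hb₁ hb₂
    apply Set.Subset.antisymm (openCluster_union_subset_of_parts ends E₁ E₂ ω₁ ω₂ a b hsep h₁ h₂ hb₁ hb₂)
    exact Set.union_subset (hmono a Finset.subset_union_left) (hmono a Finset.subset_union_right)
  have hQb : ∀ ω₁ ω₂, ω₁ ⊆ E₁ → ω₂ ⊆ E₂ → b ∉ C (E₁ \ ω₁) a → b ∉ C (E₂ \ ω₂) a →
      C ((E₁ \ ω₁) ∪ (E₂ \ ω₂)) b = C (E₁ \ ω₁) b ∪ C (E₂ \ ω₂) b := by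
    intro ω₁ ω₂ h₁ h₂ hb₁ hb₂
    have ha₁ : a ∉ C (E₁ \ ω₁) b := fun h' => hb₁ ((mem_openCluster_comm ends (E₁ \ ω₁) a b).mpr h')
    have ha₂ : a ∉ C (E₂ \ ω₂) b := fun h' => hb₂ ((mem_openCluster_comm ends (E₂ \ ω₂) a b).mpr h')
    apply Set.Subset.antisymm
      (openCluster_union_subset_of_parts ends E₁ E₂ (E₁ \ ω₁) (E₂ \ ω₂) b a hsep' Finset.sdiff_subset Finset.sdiff_subset ha₁ ha₂)
    exact Set.union_subset (hmono b Finset.subset_union_left) (hmono b Finset.subset_union_right)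
  -- Step B: the wall sum of the composition
  have hB : ∑ ω ∈ (E₁ ∪ E₂).powerset.filter (fun ω : Finset ι => b ∉ C ω a ∧ b ∉ C ((E₁ ∪ E₂) \ ω) a),
        (ha (C ω a) - hb (C ((E₁ ∪ E₂) \ ω) b)) * (ka (C ω a) - kb (C ((E₁ ∪ E₂) \ ω) b)) =
      ∑ ω₂ ∈ T₂, ∑ ω₁ ∈ T₁, Dem ω₂ ω₁ := by
    rw [Finset.sum_filter, sum_powerset_union_disjoint hdisj, Finset.sum_comm, hT₂, Finset.sum_filter]
    refine Finset.sum_congr rfl fun ω₂ hω₂ => ?_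
    have h₂ : ω₂ ⊆ E₂ := Finset.mem_powerset.mp hω₂
    by_cases w2 : (b ∉ C ω₂ a ∧ b ∉ C (E₂ \ ω₂) a)
    · rw [if_pos w2, hT₁, Finset.sum_filter]
      refine Finset.sum_congr rfl fun ω₁ hω₁ => ?_
      have h₁ : ω₁ ⊆ E₁ := Finset.mem_powerset.mp hω₁
      by_cases w1 : (b ∉ C ω₁ a ∧ b ∉ C (E₁ \ ω₁) a)
      · rw [if_pos w1, if_pos ((hwall ω₁ ω₂ h₁ h₂).mpr ⟨w1, w2⟩), hsd ω₁ ω₂ h₁ h₂, hPa ω₁ ω₂ h₁ h₂ w1.1 w2.1,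
          hQb ω₁ ω₂ h₁ h₂ w1.2 w2.2]
      · rw [if_neg w1, if_neg (fun h' => w1 ((hwall ω₁ ω₂ h₁ h₂).mp h').1)]
    · rw [if_neg w2]
      refine Finset.sum_eq_zero fun ω₁ hω₁ => ?_
      rw [if_neg (fun h' => w2 ((hwall ω₁ ω₂ (Finset.mem_powerset.mp hω₁) h₂).mp h').2)]
  -- Step A: the supply of the composition dominates the glued supplies on the image slices
  set G : Finset ι → ℝ := fun ω₂ => ∑ ω₁ ∈ E₁.powerset, h (C (ω₁ ∪ ω₂) a ∪ C (ω₁ ∪ ω₂) b) * k (C (ω₁ ∪ ω₂) a ∪ C (ω₁ ∪ ω₂) b) with hG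
  have hA1 : ∑ ω ∈ (E₁ ∪ E₂).powerset, h (C ω a ∪ C ω b) * k (C ω a ∪ C ω b) = ∑ ω₂ ∈ E₂.powerset, G ω₂ := by
    rw [sum_powerset_union_disjoint hdisj, Finset.sum_comm]
  have hGnn : ∀ ω₂, 0 ≤ G ω₂ := fun ω₂ => Finset.sum_nonneg fun ω₁ _ => mul_nonneg (h0 _) (k0 _)
  have hT₂mem : ∀ {ω₂}, ω₂ ∈ T₂ ↔ ω₂ ⊆ E₂ ∧ (b ∉ C ω₂ a ∧ b ∉ C (E₂ \ ω₂) a) := fun {ω₂} => by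
    rw [hT₂, Finset.mem_filter, Finset.mem_powerset]
  have hA2 : ∑ ω₂ ∈ T₂, G (ψ₂ ω₂) ≤ ∑ ω₂ ∈ E₂.powerset, G ω₂ := by
    have hinj : ∀ x ∈ T₂, ∀ y ∈ T₂, ψ₂ x = ψ₂ y → x = y := by
      intro x hx y hy hxy
      obtain ⟨hxE, hxR, hxB⟩ := hT₂mem.mp hx
      obtain ⟨hyE, hyR, hyB⟩ := hT₂mem.mp hy
      exact hψinj x y hxE hxR hxB hyE hyR hyB hxy
    rw [← Finset.sum_image hinj]
    refine Finset.sum_le_sum_of_subset_of_nonneg ?_ (fun ω₂ _ _ => hGnn ω₂)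
    intro η hη
    obtain ⟨x, hx, rfl⟩ := Finset.mem_image.mp hη
    obtain ⟨hxE, hxR, hxB⟩ := hT₂mem.mp hx
    exact Finset.mem_powerset.mpr (hψE x hxE hxR hxB)
  have hA3 : ∀ ω₂ ∈ T₂, ∑ ω₁ ∈ E₁.powerset, Sup ω₂ ω₁ ≤ G (ψ₂ ω₂) := by
    intro ω₂ _
    refine Finset.sum_le_sum fun ω₁ _ => ?_
    have hsub : (C ω₁ a ∪ C ω₁ b) ∪ (C (ψ₂ ω₂) a ∪ C (ψ₂ ω₂) b) ⊆ C (ω₁ ∪ ψ₂ ω₂) a ∪ C (ω₁ ∪ ψ₂ ω₂) b := by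
      refine Set.union_subset (Set.union_subset_union (hmono a Finset.subset_union_left) (hmono b Finset.subset_union_left)) ?_
      exact Set.union_subset_union (hmono a Finset.subset_union_right) (hmono b Finset.subset_union_right)
    exact mul_le_mul (hh hsub) (hk hsub) (k0 _) (h0 _)
  -- Step C: sum the hypotheses over the wall of `E₂`
  have hCsum : 0 ≤ ∑ ω₂ ∈ T₂, ((∑ ω₁ ∈ E₁.powerset, Sup ω₂ ω₁) + ∑ ω₁ ∈ T₁, Dem ω₂ ω₁) := by
    refine Finset.sum_nonneg fun ω₂ hω₂ => ?_
    obtain ⟨h₂, hR, hBl⟩ := hT₂mem.mp hω₂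
    exact hmix ω₂ h₂ hR hBl
  rw [Finset.sum_add_distrib] at hCsum
  have hA4 : ∑ ω₂ ∈ T₂, ∑ ω₁ ∈ E₁.powerset, Sup ω₂ ω₁ ≤ ∑ ω₂ ∈ T₂, G (ψ₂ ω₂) := Finset.sum_le_sum hA3
  rw [hA1, hB]
  linarith

end Coefficientwise

end Summit.CriticalPhenomena.PercolationContinuityZ3.Theorems
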